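import Literature.AlgebraicGeometry.ShimuraVarieties.UnitaryCurveAuxiliarySymplecticLevelV
import Literature.AlgebraicGeometry.ShimuraVarieties.UnitaryCurveAuxiliarySymplecticFrameV
import Literature.AlgebraicGeometry.ShimuraVarieties.UnitaryAuxiliaryLevelContainment
import HarnessLib

/-!
# The `W₀`-free auxiliary level contains a given compact subgroup: `K × L₀ ≤ K̃_V(1)` for an adapted integral frame, any rank `n`

Topic `AlgebraicGeometry/ShimuraVarieties`; namespace `Literature.AlgebraicGeometry.ShimuraVarieties.UnitaryCurve.AuxV`.
Theorems only (no definition, no named fact, no instance).  Cell `hodgecm-mathlib` (D-0151), FLOOR 0, P6 «MOD programme», door (E) of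
`stub_RGD`, organ **E1 FILE 6** — the `V_M`-twin of ★ `UnitaryCanonicalModel.Aux.exists_symplecticFrame_prod_le_auxLevel_one`
(★ `UnitaryAuxiliaryLevelContainment`, rank 3, `W₀ ⊕ V_M`) over ★ E1 FILES 2b∕3b∕5 (`auxToGspFinV`, `auxLevelV`, `auxResFinV`,
`coe_auxToGspFinV_eq_conjRect`, `continuous_auxResFinV`, `exists_symplecticFrameV_integral`): the LEVEL CHOICE of the E-LINE chart
`stub_E123` (`Cruxes/HLiu418/Lines/F0_P6a_PELWitnessE.lean`; [RapoportSmithlingZhang2020Diagonal] Remark 3.2 (ii)(iii), (3.10)).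
`--supports stmt-HodgeConjecture-24832`, count-neutral; HC_CM is proved only modulo the printed citations until rung 0 closes.

Deligne's auxiliary construction [cite: Deligne1979ShimuraVarieties, Prop. 2.3.10 (PDF p. 32)], [cite: Deligne1971TravauxShimura, Prop. 1.15 p. 132],
level step, for `GU(V)` alone: given compact subgroups `K ≤ U(H)(𝔸_f)` and `L₀ ≤ T₀(M)(𝔸_f)`, the compact image of `K × L₀` in
`GL_{n×[M:ℚ]}(𝔸_{ℚ,f})` under the frame-free carrier ★ `auxResFinV` stabilises a full `ℤ`-lattice `Λ ⊆ M^n`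
(★ `Adeles.exists_rat_conj_entries_mem_integralFiniteAdeles`); an integral symplectic frame `β` of some polarisation type `δ` adapted to
`Λ` for a positive multiple `k • ψ_V` (★ `exists_symplecticFrameV_integral`) then reads every element of `K × L₀` as a matrix in
`GSp_δ(ℤ̂) = K_δ(1)`:

* §1 HEAD `exists_symplecticFrameV_prod_le_auxLevelV_one`: `∃ k g δ (Fr : SymplecticFrameV M j H (k•ξ) g δ), 0 < k ∧ 0 < g ∧
  IsPolarizationType δ ∧ K.prod L₀ ≤ auxLevelV Fr 1`.
* §2 the unitary slice for the chart (`b := (auxToGspFinV Fr).comp (MonoidHom.inl _ _)`, torus coordinate `1`):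
  `exists_symplecticFrameV_le_comap_inl_auxLevelV_one` (`K ≤ K̃_V(1).comap inl`), and the SHRINK to level `N`:
  `inf_comap_inl_auxLevelV_le` ∕ `isOpen_inf_comap_inl_auxLevelV` ∕ `isCompact_inf_comap_inl_auxLevelV`
  (`K ⊓ inl⁻¹ K̃_V(N)` is an open compact subgroup of `K` mapped by `b` into `K_δ(N)`, `N ≠ 0`).

## References
* [Deligne1979ShimuraVarieties] P. Deligne, *Variétés de Shimura* (1979), Prop. 2.3.10, 2.1.2 (PDF pp. 32, 24 of Milne's translation).
* [Deligne1971TravauxShimura] P. Deligne, *Travaux de Shimura* (1971), Prop. 1.15 p. 132, Exemple 4.16 p. 150.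
* [RapoportSmithlingZhang2020Diagonal] M. Rapoport, B. Smithling, W. Zhang, Compos. Math. 156 (2020), Remark 3.2 (ii)(iii) pp. 9–10, (3.10) p. 14.
* [PlatonovRapinchuk1994] V. Platonov, A. Rapinchuk, *Algebraic groups and number theory* (1994), §8.1.
-/

set_option autoImplicit false

noncomputable section

open Matrix NumberField IsDedekindDomain
open _root_.Topology
open scoped TensorProduct
open Literature.AlgebraicGeometry.ModuliOfAbelianVarieties Literature.LinearAlgebra.FreeModule
open Literature.NumberTheory.Automorphic (integralFiniteAdeles)

namespace Literature.AlgebraicGeometry.ShimuraVarieties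

namespace UnitaryCurve

namespace AuxV

open Literature.AlgebraicGeometry.ShimuraVarieties.UnitaryCanonicalModel.Aux (ratBasis torusFinAdelic map_intCast_mul
  isCongOne_one_of_forall_mem_integral forall_mem_integral_intConj)
open Literature.NumberTheory.Automorphic Literature.NumberTheory.Automorphic.UnitaryGroup

variable {L : Type} [Field L] [NumberField L] [IsCMField L] {M : Type} [Field M] [NumberField M] [IsCMField M]
  (j : L →+* M) {n : ℕ} (H : Matrix (Fin n) (Fin n) L) (ξ : M)

/-! ### §1. The containment `K × L₀ ≤ K̃_V(1)` for an adapted integral frame -/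

/-- **`K × L₀ ≤ K̃_V(1)` for a suitable integral frame** (Deligne's auxiliary construction, the level step, `W₀`-free): for `H^j`
hermitian, `H` invertible, `ξ` nonzero purely imaginary, `n ≠ 0` and compact subgroups `K ≤ U(H)(𝔸_f)`, `L₀ ≤ T₀(M)(𝔸_f)`, there are
`k > 0`, `g > 0`, a polarisation type `δ` and a symplectic frame `Fr` of type `δ` for `auxFormV M j H (k•ξ)` with
`K × L₀ ≤ auxLevelV Fr 1`, i.e. the framed carrier `ũ_β` maps `K × L₀` into the principal level `K_δ(1) = GSp_δ(ℤ̂)`.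
[cite: Deligne1979ShimuraVarieties, Prop. 2.3.10 (PDF p. 32)] [cite: Deligne1971TravauxShimura, Prop. 1.15 p. 132]
[cite: RapoportSmithlingZhang2020Diagonal, Remark 3.2 (ii)(iii) pp. 9–10] -/
theorem exists_symplecticFrameV_prod_le_auxLevelV_one [NeZero n] (hH : (H.map j)ᴴ = H.map j) (hHu : IsUnit H) (hξ : ξ ≠ 0)
    (hξc : IsCMField.complexConj M ξ = -ξ)
    (K : Subgroup ↥(finAdelic (↥(maximalRealSubfield L)) L (IsCMField.complexConj L) n H))
    (L₀ : Subgroup ↥(torusFinAdelic M))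
    (hK : IsCompact (K : Set ↥(finAdelic (↥(maximalRealSubfield L)) L (IsCMField.complexConj L) n H)))
    (hL₀ : IsCompact (L₀ : Set ↥(torusFinAdelic M))) :
    ∃ (k g : ℕ) (δ : Fin g → ℕ) (Fr : SymplecticFrameV M j H ((k : ℚ) • ξ) g δ),
      0 < k ∧ 0 < g ∧ IsPolarizationType δ ∧ K.prod L₀ ≤ auxLevelV Fr 1 := by
  classical
  -- the compact image `C` of `K × L₀` under the frame-free carrier
  set C : Subgroup (GL (Fin n × Fin (Module.finrank ℚ M)) finAdeleQ) := (K.prod L₀).map (auxResFinV M j H) with hC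
  have hCc : IsCompact (C : Set (GL (Fin n × Fin (Module.finrank ℚ M)) finAdeleQ)) := by
    rw [hC, Subgroup.coe_map, Subgroup.coe_prod]
    exact (hK.prod hL₀).image (continuous_auxResFinV M j H)
  obtain ⟨γ, hγ⟩ := Literature.NumberTheory.Adeles.exists_rat_conj_entries_mem_integralFiniteAdeles C hCc
  -- the `γ`-twisted rational basis `c` of `V_M = M^n`: `c⁎ = γ ∘ e⁎`, `e = resBasis (ratBasis M)`
  set e : Module.Basis (Fin n × Fin (Module.finrank ℚ M)) ℚ (Fin n → M) := resBasis (m := Fin n) (ratBasis M) with he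
  set γm : Matrix (Fin n × Fin (Module.finrank ℚ M)) (Fin n × Fin (Module.finrank ℚ M)) ℚ :=
    ((γ : GL (Fin n × Fin (Module.finrank ℚ M)) ℚ) : Matrix (Fin n × Fin (Module.finrank ℚ M)) (Fin n × Fin (Module.finrank ℚ M)) ℚ)
    with hγm
  set γi : Matrix (Fin n × Fin (Module.finrank ℚ M)) (Fin n × Fin (Module.finrank ℚ M)) ℚ :=
    ((γ⁻¹ : GL (Fin n × Fin (Module.finrank ℚ M)) ℚ) : Matrix (Fin n × Fin (Module.finrank ℚ M)) (Fin n × Fin (Module.finrank ℚ M)) ℚ)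
    with hγi
  have hγmi : γm * γi = 1 := by rw [hγm, hγi, ← Units.val_mul, mul_inv_cancel, Units.val_one]
  have hγim : γi * γm = 1 := by rw [hγm, hγi, ← Units.val_mul, inv_mul_cancel, Units.val_one]
  let θγ : ((Fin n × Fin (Module.finrank ℚ M)) → ℚ) ≃ₗ[ℚ] ((Fin n × Fin (Module.finrank ℚ M)) → ℚ) :=
    LinearEquiv.ofLinear (Matrix.toLin' γm) (Matrix.toLin' γi)
      (by rw [← Matrix.toLin'_mul, hγmi, Matrix.toLin'_one])
      (by rw [← Matrix.toLin'_mul, hγim, Matrix.toLin'_one])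
  let c : Module.Basis (Fin n × Fin (Module.finrank ℚ M)) ℚ (Fin n → M) := Module.Basis.ofEquivFun (e.equivFun.trans θγ)
  have hc : ∀ u, c.equivFun u = γm *ᵥ e.equivFun u := fun u => by
    rw [Module.Basis.equivFun_ofEquivFun]
    exact Matrix.toLin'_apply γm _
  -- the integral frame adapted to `c`
  obtain ⟨k, g, δ, F, T, T', hk, hg, hδ, hTT', hT'T, -, hβ⟩ :=
    exists_symplecticFrameV_integral j H ξ c hH hHu hξ hξc
  refine ⟨k, g, δ, F, hk, hg, hδ, ?_⟩
  -- frame matrices: `P = T γ`, `Q = γ⁻¹ T′`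
  set Tq : Matrix (Fin g ⊕ Fin g) (Fin n × Fin (Module.finrank ℚ M)) ℚ := T.map (Int.cast : ℤ → ℚ) with hTq
  set T'q : Matrix (Fin n × Fin (Module.finrank ℚ M)) (Fin g ⊕ Fin g) ℚ := T'.map (Int.cast : ℤ → ℚ) with hT'q
  have hT'Tq : T'q * Tq = 1 := by
    rw [hTq, hT'q, ← map_intCast_mul, hT'T, Matrix.map_one Int.cast Int.cast_zero Int.cast_one]
  have hes : ∀ ik, e.equivFun (e ik) = Pi.single ik 1 := fun ik => by
    rw [Module.Basis.equivFun_apply, e.repr_self, Finsupp.single_eq_pi_single]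
  have hP : framePV F = Tq * γm := by
    ext a ik
    rw [framePV, LinearMap.toMatrix_apply, Pi.basisFun_repr, LinearEquiv.coe_coe, ← he, hβ, hc, hes, Matrix.mulVec_mulVec,
      Matrix.mulVec_single_one, Matrix.col_apply]
  have hQ : frameQV F = γi * T'q := by
    have h1 : (γi * T'q) * framePV F = 1 := by
      rw [hP, Matrix.mul_assoc, ← Matrix.mul_assoc T'q, hT'Tq, Matrix.one_mul, hγim]
    calc frameQV F = (γi * T'q) * framePV F * frameQV F := by rw [h1, Matrix.one_mul]
      _ = γi * T'q := by rw [Matrix.mul_assoc, framePV_mul_frameQV, Matrix.mul_one]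
  -- over `𝔸_{ℚ,f}`
  set ι𝔸 : ℚ →+* finAdeleQ := algebraMap ℚ finAdeleQ with hι
  have hPA : framePVR finAdeleQ F = T.map (Int.cast : ℤ → finAdeleQ) * γm.map ι𝔸 := by
    rw [framePVR, hP, ← hι, Matrix.map_mul, hTq, Matrix.map_map]
    congr 1
    ext a ik
    simp only [Matrix.map_apply, Function.comp_apply, map_intCast]
  have hQA : frameQVR finAdeleQ F = γi.map ι𝔸 * T'.map (Int.cast : ℤ → finAdeleQ) := by
    rw [frameQVR, hQ, ← hι, Matrix.map_mul, hT'q, Matrix.map_map]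
    congr 1
    ext ik a
    simp only [Matrix.map_apply, Function.comp_apply, map_intCast]
  have hγA : ((Matrix.GeneralLinearGroup.map ι𝔸 γ : GL (Fin n × Fin (Module.finrank ℚ M)) finAdeleQ) :
      Matrix (Fin n × Fin (Module.finrank ℚ M)) (Fin n × Fin (Module.finrank ℚ M)) finAdeleQ) = γm.map ι𝔸 := rfl
  have hγA' : (((Matrix.GeneralLinearGroup.map ι𝔸 γ)⁻¹ : GL (Fin n × Fin (Module.finrank ℚ M)) finAdeleQ) :
      Matrix (Fin n × Fin (Module.finrank ℚ M)) (Fin n × Fin (Module.finrank ℚ M)) finAdeleQ) = γi.map ι𝔸 := by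
    rw [← map_inv]; rfl
  -- the containment
  rintro p hp
  have hX : auxResFinV M j H p ∈ C := by
    rw [hC]; exact Subgroup.mem_map_of_mem _ hp
  obtain ⟨h1, h2⟩ := hγ _ hX
  rw [mem_auxLevelV_iff]
  have key : ∀ Z : GL (Fin n × Fin (Module.finrank ℚ M)) finAdeleQ,
      (∀ i k, ((Matrix.GeneralLinearGroup.map ι𝔸 γ * Z * (Matrix.GeneralLinearGroup.map ι𝔸 γ)⁻¹ :
        GL (Fin n × Fin (Module.finrank ℚ M)) finAdeleQ) :
          Matrix (Fin n × Fin (Module.finrank ℚ M)) (Fin n × Fin (Module.finrank ℚ M)) finAdeleQ) i k ∈ integralFiniteAdeles ℚ) →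
      IsCongOne 1 (framePVR finAdeleQ F *
        (Z : Matrix (Fin n × Fin (Module.finrank ℚ M)) (Fin n × Fin (Module.finrank ℚ M)) finAdeleQ) * frameQVR finAdeleQ F) := by
    intro Z hZ
    rw [Units.val_mul, Units.val_mul, hγA, hγA'] at hZ
    have hmul : framePVR finAdeleQ F * (Z : Matrix (Fin n × Fin (Module.finrank ℚ M)) (Fin n × Fin (Module.finrank ℚ M)) finAdeleQ) *
          frameQVR finAdeleQ F =
        T.map (Int.cast : ℤ → finAdeleQ) *
            (γm.map ι𝔸 * (Z : Matrix (Fin n × Fin (Module.finrank ℚ M)) (Fin n × Fin (Module.finrank ℚ M)) finAdeleQ) * γi.map ι𝔸) *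
          T'.map (Int.cast : ℤ → finAdeleQ) := by
      rw [hPA, hQA]
      simp only [Matrix.mul_assoc]
    rw [hmul]
    exact isCongOne_one_of_forall_mem_integral (forall_mem_integral_intConj T T' hZ)
  refine ⟨?_, ?_⟩
  · rw [coe_auxToGspFinV_eq_conjRect]
    exact key _ h1
  · rw [coe_auxToGspFinV_eq_conjRect, ← map_inv]
    exact key _ h2

/-! ### §2. The unitary slice of the chart and its shrink to level `N` -/

/-- **The chart's level at torus coordinate `1`**: for a compact `K ≤ U(H)(𝔸_f)` there is an adapted integral frame `Fr` with
`K ≤ K̃_V(1).comap inl`, i.e. `b := (auxToGspFinV Fr).comp (MonoidHom.inl _ _)` maps `K` into `K_δ(1) = GSp_δ(ℤ̂)`.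
[cite: Deligne1979ShimuraVarieties, Prop. 2.3.10 (PDF p. 32)] [cite: RapoportSmithlingZhang2020Diagonal, Remark 3.2 (ii)(iii) pp. 9–10, (3.10) p. 14] -/
theorem exists_symplecticFrameV_le_comap_inl_auxLevelV_one [NeZero n] (hH : (H.map j)ᴴ = H.map j) (hHu : IsUnit H) (hξ : ξ ≠ 0)
    (hξc : IsCMField.complexConj M ξ = -ξ)
    (K : Subgroup ↥(finAdelic (↥(maximalRealSubfield L)) L (IsCMField.complexConj L) n H))
    (hK : IsCompact (K : Set ↥(finAdelic (↥(maximalRealSubfield L)) L (IsCMField.complexConj L) n H))) :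
    ∃ (k g : ℕ) (δ : Fin g → ℕ) (Fr : SymplecticFrameV M j H ((k : ℚ) • ξ) g δ),
      0 < k ∧ 0 < g ∧ IsPolarizationType δ ∧
        K ≤ (auxLevelV Fr 1).comap (MonoidHom.inl _ ↥(torusFinAdelic M)) := by
  have hbot : IsCompact ((⊥ : Subgroup ↥(torusFinAdelic M)) : Set ↥(torusFinAdelic M)) := by
    rw [Subgroup.coe_bot]
    exact isCompact_singleton
  obtain ⟨k, g, δ, Fr, hk, hg, hδ, hle⟩ :=
    exists_symplecticFrameV_prod_le_auxLevelV_one j H ξ hH hHu hξ hξc K ⊥ hK hbot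
  refine ⟨k, g, δ, Fr, hk, hg, hδ, fun a ha => ?_⟩
  rw [Subgroup.mem_comap, MonoidHom.inl_apply]
  exact hle (Subgroup.mem_prod.mpr ⟨ha, Subgroup.one_mem _⟩)

variable {j H} {ξ' : M} {g : ℕ} {δ : Fin g → ℕ}

/-- **The shrink `K ⊓ inl⁻¹ K̃_V(N) ≤ K` is mapped by `b` into `K_δ(N)`.** [cite: Deligne1971TravauxShimura, Prop. 1.15 p. 132]
[cite: RapoportSmithlingZhang2020Diagonal, (3.10) p. 14] -/
theorem inf_comap_inl_auxLevelV_le (Fr : SymplecticFrameV M j H ξ' g δ) (N : ℕ)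
    (K : Subgroup ↥(finAdelic (↥(maximalRealSubfield L)) L (IsCMField.complexConj L) n H)) :
    K ⊓ (auxLevelV Fr N).comap (MonoidHom.inl _ ↥(torusFinAdelic M)) ≤ K ∧
      K ⊓ (auxLevelV Fr N).comap (MonoidHom.inl _ ↥(torusFinAdelic M)) ≤
        (principalLevelSubgroup δ N).comap ((auxToGspFinV Fr).comp (MonoidHom.inl _ ↥(torusFinAdelic M))) :=
  ⟨inf_le_left, fun _ ha => ha.2⟩

/-- **The shrink is OPEN** when `K` is open and `N ≠ 0` (★ `isOpen_setOf_mk_one_mem_auxLevelV`). [cite: Deligne1971TravauxShimura, Prop. 1.15 p. 132] -/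
theorem isOpen_inf_comap_inl_auxLevelV (Fr : SymplecticFrameV M j H ξ' g δ) {N : ℕ} (hN : N ≠ 0)
    (K : Subgroup ↥(finAdelic (↥(maximalRealSubfield L)) L (IsCMField.complexConj L) n H))
    (hK : IsOpen (K : Set ↥(finAdelic (↥(maximalRealSubfield L)) L (IsCMField.complexConj L) n H))) :
    IsOpen ((K ⊓ (auxLevelV Fr N).comap (MonoidHom.inl _ ↥(torusFinAdelic M)) :
      Subgroup ↥(finAdelic (↥(maximalRealSubfield L)) L (IsCMField.complexConj L) n H)) :
        Set ↥(finAdelic (↥(maximalRealSubfield L)) L (IsCMField.complexConj L) n H)) := by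
  rw [Subgroup.coe_inf, Subgroup.coe_comap]
  exact hK.inter (isOpen_setOf_mk_one_mem_auxLevelV Fr hN)

/-- **The shrink is COMPACT** when `K` is compact and `N ≠ 0` (closed in `K`: ★ `isClosed_auxLevelV`). [cite: Deligne1971TravauxShimura, Prop. 1.15 p. 132] -/
theorem isCompact_inf_comap_inl_auxLevelV (Fr : SymplecticFrameV M j H ξ' g δ) {N : ℕ} (hN : N ≠ 0)
    (K : Subgroup ↥(finAdelic (↥(maximalRealSubfield L)) L (IsCMField.complexConj L) n H))
    (hK : IsCompact (K : Set ↥(finAdelic (↥(maximalRealSubfield L)) L (IsCMField.complexConj L) n H))) :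
    IsCompact ((K ⊓ (auxLevelV Fr N).comap (MonoidHom.inl _ ↥(torusFinAdelic M)) :
      Subgroup ↥(finAdelic (↥(maximalRealSubfield L)) L (IsCMField.complexConj L) n H)) :
        Set ↥(finAdelic (↥(maximalRealSubfield L)) L (IsCMField.complexConj L) n H)) := by
  rw [Subgroup.coe_inf, Subgroup.coe_comap]
  exact hK.inter_right ((isClosed_auxLevelV Fr hN).preimage (Continuous.prodMk_left 1))

end AuxV

end UnitaryCurve

end Literature.AlgebraicGeometry.ShimuraVarieties

end
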